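import Literature.AnabelianGeometry.SemiGraphs.PreimageComponents
import Literature.AnabelianGeometry.SemiGraphs.FreeGroupsAndActionsProofs2
import Literature.AnabelianGeometry.SemiGraphs.SemiGraphCuspOmission
import HarnessLib

/-!
# Reachability inside sub-semi-graphs is functorial; components of a preimage are blocks for
# automorphisms over the base; an open edge abuts to at most one vertex

Mochizuki, *Semi-graphs of anabelioids*, Publ. RIMS **42** (2006), §1 pp. 11–13 (semi-graphs,
sub-semi-graphs, morphisms), Lemma 1.8 p. 20 (group actions `Γ → Aut G` on semi-graphs, images of
sub-semi-graphs) [cite: MochizukiSemiAnbd2006, §1 pp.11-13]; used at [IUTchI] Cor. 2.3 / [IUTchII]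
Cor. 2.4 (i) p. 71 («it follows that γ′ ∈ Δ̂^±_{v□}»: the components of the inverse image of a
sub-semi-graph `□` in a finite Galois covering are permuted by the deck transformations, so an element
moving ONE vertex of a component into the same component STABILISES the component; and a cusp — an
open edge — meets exactly one vertex).

PROOF-ONLY (abc-iut cell, seat abc-iut-w4-d076; the «B4 combinatorial core» of
plan/L5/SUBDAG-IUTchI-Cor23Levels.md, bare semi-graph level, no anabelioid layer):

* `Subgraph.subdivision_adj_hom` / `Subgraph.subdivision_reachable_hom` — a morphism `φ : G ⟶ G′`
  carrying a sub-semi-graph `K ⊆ G` into `L ⊆ G′` induces a homomorphism of the barycentric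
  subdivisions `K → L`, hence preserves reachability (generalises `Subgraph.subdivision_adj_inclusion`);
* `Subgraph.reachable_inl_aut_iff` — for an automorphism `σ` of `G` with `σ(D) = D` (as sets of
  vertices and edges), reachability of vertices inside `D` is `σ`-INVARIANT;
* `preimage_block_of_over` — for `σ ∈ Aut G′` OVER `p : G′ ⟶ G` (`σ ≫ p = p`) and `ℍ ⊆ G`, the
  reachability class («connected component») of a vertex `c` inside `p⁻¹(ℍ)` is a BLOCK: if `σ` moves
  some vertex of the class into the class, it maps the whole class into itself; action form
  `preimage_block_of_action` for `ρ : Γ →* Aut G′` over `p`;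
* `eq_of_edgeAbuts_of_vertCard_le_one` — an edge of verticial cardinality `≤ 1` (an open edge, e.g.
  a cusp of a dual semi-graph) abuts to at most one vertex.

No definitions, no named facts; nothing here takes a side on any disputed claim downstream.
-/

namespace Literature.AnabelianGeometry.SemiGraphs

namespace SemiGraph

open CategoryTheory

universe u

variable {G G' : SemiGraph.{u}}

/-! ### Functoriality of reachability inside sub-semi-graphs -/

/-- A morphism `φ : G ⟶ G′` carrying the sub-semi-graph `K ⊆ G` into `L ⊆ G′` maps adjacent nodes of
the subdivision of `K` to adjacent nodes of the subdivision of `L` (adjacency in `K` is adjacency in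
`G`, is mapped by `φ`, and lifts to `L`). [cite: MochizukiSemiAnbd2006, §1 p.12] -/
theorem Subgraph.subdivision_adj_hom (φ : G ⟶ G') {K : G.Subgraph} {L : G'.Subgraph}
    (hV : ∀ v ∈ K.verts, φ.vertexMap v ∈ L.verts) (hE : ∀ e ∈ K.edges, φ.edgeMap e ∈ L.edges)
    {x y : K.toSemiGraph.Node} (h : K.toSemiGraph.subdivision.Adj x y) :
    L.toSemiGraph.subdivision.Adj
      (Sum.map (fun v => (⟨φ.vertexMap v.1, hV v.1 v.2⟩ : L.toSemiGraph.Vertex))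
        (Sum.map (fun e => (⟨φ.edgeMap e.1, hE e.1 e.2⟩ : L.toSemiGraph.Edge))
          (fun b => (⟨φ.branchMap b.1, by rw [φ.edgeOf_branchMap]; exact hE _ b.2⟩ : L.toSemiGraph.Branch))) x)
      (Sum.map (fun v => (⟨φ.vertexMap v.1, hV v.1 v.2⟩ : L.toSemiGraph.Vertex))
        (Sum.map (fun e => (⟨φ.edgeMap e.1, hE e.1 e.2⟩ : L.toSemiGraph.Edge))
          (fun b => (⟨φ.branchMap b.1, by rw [φ.edgeOf_branchMap]; exact hE _ b.2⟩ : L.toSemiGraph.Branch))) y) := by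
  apply L.subdivision_adj_of_adj_map_ι
  have h' := subdivision_adj_map φ (subdivision_adj_map K.ι h)
  rcases x with xv | xe | xb <;> rcases y with yv | ye | yb <;> exact h'

/-- **Reachability inside sub-semi-graphs is functorial.** A morphism `φ : G ⟶ G′` carrying
`K ⊆ G` into `L ⊆ G′` maps nodes joined by a walk of the subdivision of `K` to nodes joined by a walk of
the subdivision of `L`. [cite: MochizukiSemiAnbd2006, §1 p.12] -/
theorem Subgraph.subdivision_reachable_hom (φ : G ⟶ G') {K : G.Subgraph} {L : G'.Subgraph}
    (hV : ∀ v ∈ K.verts, φ.vertexMap v ∈ L.verts) (hE : ∀ e ∈ K.edges, φ.edgeMap e ∈ L.edges)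
    {x y : K.toSemiGraph.Node} (h : K.toSemiGraph.subdivision.Reachable x y) :
    L.toSemiGraph.subdivision.Reachable
      (Sum.map (fun v => (⟨φ.vertexMap v.1, hV v.1 v.2⟩ : L.toSemiGraph.Vertex))
        (Sum.map (fun e => (⟨φ.edgeMap e.1, hE e.1 e.2⟩ : L.toSemiGraph.Edge))
          (fun b => (⟨φ.branchMap b.1, by rw [φ.edgeOf_branchMap]; exact hE _ b.2⟩ : L.toSemiGraph.Branch))) x)
      (Sum.map (fun v => (⟨φ.vertexMap v.1, hV v.1 v.2⟩ : L.toSemiGraph.Vertex))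
        (Sum.map (fun e => (⟨φ.edgeMap e.1, hE e.1 e.2⟩ : L.toSemiGraph.Edge))
          (fun b => (⟨φ.branchMap b.1, by rw [φ.edgeOf_branchMap]; exact hE _ b.2⟩ : L.toSemiGraph.Branch))) y) := by
  let f : K.toSemiGraph.subdivision →g L.toSemiGraph.subdivision :=
    { toFun := Sum.map (fun v => (⟨φ.vertexMap v.1, hV v.1 v.2⟩ : L.toSemiGraph.Vertex))
        (Sum.map (fun e => (⟨φ.edgeMap e.1, hE e.1 e.2⟩ : L.toSemiGraph.Edge))
          (fun b => (⟨φ.branchMap b.1, by rw [φ.edgeOf_branchMap]; exact hE _ b.2⟩ : L.toSemiGraph.Branch)))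
      map_rel' := fun hxy => Subgraph.subdivision_adj_hom φ hV hE hxy }
  exact h.map f

/-- Vertex-to-vertex form of `Subgraph.subdivision_reachable_hom`.
[cite: MochizukiSemiAnbd2006, §1 p.12] -/
theorem Subgraph.reachable_inl_hom (φ : G ⟶ G') {K : G.Subgraph} {L : G'.Subgraph}
    (hV : ∀ v ∈ K.verts, φ.vertexMap v ∈ L.verts) (hE : ∀ e ∈ K.edges, φ.edgeMap e ∈ L.edges)
    {v w : G.Vertex} (hv : v ∈ K.verts) (hw : w ∈ K.verts)
    (h : K.toSemiGraph.subdivision.Reachable (Sum.inl ⟨v, hv⟩) (Sum.inl ⟨w, hw⟩)) :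
    L.toSemiGraph.subdivision.Reachable (Sum.inl ⟨φ.vertexMap v, hV v hv⟩)
      (Sum.inl ⟨φ.vertexMap w, hV w hw⟩) :=
  Subgraph.subdivision_reachable_hom φ hV hE h

/-- Vertex-to-edge form of `Subgraph.subdivision_reachable_hom`.
[cite: MochizukiSemiAnbd2006, §1 p.12] -/
theorem Subgraph.reachable_inl_inr_hom (φ : G ⟶ G') {K : G.Subgraph} {L : G'.Subgraph}
    (hV : ∀ v ∈ K.verts, φ.vertexMap v ∈ L.verts) (hE : ∀ e ∈ K.edges, φ.edgeMap e ∈ L.edges)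
    {v : G.Vertex} {e : G.Edge} (hv : v ∈ K.verts) (he : e ∈ K.edges)
    (h : K.toSemiGraph.subdivision.Reachable (Sum.inl ⟨v, hv⟩) (Sum.inr (Sum.inl ⟨e, he⟩))) :
    L.toSemiGraph.subdivision.Reachable (Sum.inl ⟨φ.vertexMap v, hV v hv⟩)
      (Sum.inr (Sum.inl ⟨φ.edgeMap e, hE e he⟩)) :=
  Subgraph.subdivision_reachable_hom φ hV hE h

/-! ### Automorphisms: bookkeeping in `Aut G` -/

/-- The underlying morphism of `σ⁻¹ ∈ Aut G` is `σ.inv`. [cite: MochizukiSemiAnbd2006, Lem. 1.8 p.20] -/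
theorem Aut.inv_hom (σ : Aut G) : (σ⁻¹).hom = σ.inv := rfl

/-- An automorphism over `p : G ⟶ B` has inverse over `p`. [cite: MochizukiSemiAnbd2006, Lem. 1.8 p.20] -/
theorem Aut.inv_comp_eq_of_hom_comp_eq {B : SemiGraph.{u}} (p : G ⟶ B) (σ : Aut G)
    (hσ : σ.hom ≫ p = p) : σ.inv ≫ p = p := by
  calc σ.inv ≫ p = σ.inv ≫ (σ.hom ≫ p) := by rw [hσ]
    _ = p := by rw [← Category.assoc, σ.inv_hom_id, Category.id_comp]

/-- Over `p`, `σ` does not change the image vertex: `p (σ v) = p v`.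
[cite: MochizukiSemiAnbd2006, Lem. 1.8 p.20] -/
theorem Aut.base_vertexMap_eq {B : SemiGraph.{u}} (p : G ⟶ B) (σ : Aut G) (hσ : σ.hom ≫ p = p)
    (v : G.Vertex) : p.vertexMap (σ.hom.vertexMap v) = p.vertexMap v := by
  change (σ.hom ≫ p).vertexMap v = _
  rw [hσ]

/-- Over `p`, `σ` does not change the image edge: `p (σ e) = p e`.
[cite: MochizukiSemiAnbd2006, Lem. 1.8 p.20] -/
theorem Aut.base_edgeMap_eq {B : SemiGraph.{u}} (p : G ⟶ B) (σ : Aut G) (hσ : σ.hom ≫ p = p)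
    (e : G.Edge) : p.edgeMap (σ.hom.edgeMap e) = p.edgeMap e := by
  change (σ.hom ≫ p).edgeMap e = _
  rw [hσ]

/-! ### Reachability inside an invariant sub-semi-graph is invariant under automorphisms -/

/-- **Invariance.** If `σ ∈ Aut G` maps the sub-semi-graph `D` into itself and so does `σ⁻¹`, then two
vertices of `D` are joined by a walk of the subdivision of `D` iff their `σ`-images are.
[cite: MochizukiSemiAnbd2006, Lem. 1.8 p.20] -/
theorem Subgraph.reachable_inl_aut_iff (D : G.Subgraph) (σ : Aut G)
    (hV : ∀ v ∈ D.verts, σ.hom.vertexMap v ∈ D.verts) (hE : ∀ e ∈ D.edges, σ.hom.edgeMap e ∈ D.edges)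
    (hV' : ∀ v ∈ D.verts, σ.inv.vertexMap v ∈ D.verts) (hE' : ∀ e ∈ D.edges, σ.inv.edgeMap e ∈ D.edges)
    {v w : G.Vertex} (hv : v ∈ D.verts) (hw : w ∈ D.verts) :
    D.toSemiGraph.subdivision.Reachable (Sum.inl ⟨σ.hom.vertexMap v, hV v hv⟩)
        (Sum.inl ⟨σ.hom.vertexMap w, hV w hw⟩) ↔
      D.toSemiGraph.subdivision.Reachable (Sum.inl ⟨v, hv⟩) (Sum.inl ⟨w, hw⟩) := by
  constructor
  · intro h
    have h' := Subgraph.reachable_inl_hom σ.inv hV' hE' (hV v hv) (hV w hw) h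
    have e1 : (⟨σ.inv.vertexMap (σ.hom.vertexMap v), hV' _ (hV v hv)⟩ : D.toSemiGraph.Vertex) =
        ⟨v, hv⟩ := Subtype.ext (inv_vertexMap_hom_vertexMap σ v)
    have e2 : (⟨σ.inv.vertexMap (σ.hom.vertexMap w), hV' _ (hV w hw)⟩ : D.toSemiGraph.Vertex) =
        ⟨w, hw⟩ := Subtype.ext (inv_vertexMap_hom_vertexMap σ w)
    rw [e1, e2] at h'
    exact h'
  · intro h
    exact Subgraph.reachable_inl_hom σ.hom hV hE hv hw h

/-! ### Components of a preimage are blocks for automorphisms over the base -/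

section Preimage

variable {B : SemiGraph.{u}} (p : G ⟶ B) (H : B.Subgraph)

/-- An automorphism `σ` of `G` over `p : G ⟶ B` maps the full preimage `p⁻¹(ℍ)` into itself
(vertices). [cite: MochizukiSemiAnbd2006, Lem. 1.8 p.20] -/
theorem preimage_verts_aut (σ : Aut G) (hσ : σ.hom ≫ p = p) :
    ∀ v ∈ (⟨p.vertexMap ⁻¹' H.verts, p.edgeMap ⁻¹' H.edges⟩ : G.Subgraph).verts,
      σ.hom.vertexMap v ∈ (⟨p.vertexMap ⁻¹' H.verts, p.edgeMap ⁻¹' H.edges⟩ : G.Subgraph).verts := by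
  intro v hv
  change p.vertexMap (σ.hom.vertexMap v) ∈ H.verts
  rw [Aut.base_vertexMap_eq p σ hσ]
  exact hv

/-- An automorphism `σ` of `G` over `p : G ⟶ B` maps the full preimage `p⁻¹(ℍ)` into itself
(edges). [cite: MochizukiSemiAnbd2006, Lem. 1.8 p.20] -/
theorem preimage_edges_aut (σ : Aut G) (hσ : σ.hom ≫ p = p) :
    ∀ e ∈ (⟨p.vertexMap ⁻¹' H.verts, p.edgeMap ⁻¹' H.edges⟩ : G.Subgraph).edges,
      σ.hom.edgeMap e ∈ (⟨p.vertexMap ⁻¹' H.verts, p.edgeMap ⁻¹' H.edges⟩ : G.Subgraph).edges := by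
  intro e he
  change p.edgeMap (σ.hom.edgeMap e) ∈ H.edges
  rw [Aut.base_edgeMap_eq p σ hσ]
  exact he

/-- **Invariance of reachability in the preimage** under an automorphism over the base.
[cite: MochizukiSemiAnbd2006, Lem. 1.8 p.20] -/
theorem preimage_reachable_inl_aut_iff (σ : Aut G) (hσ : σ.hom ≫ p = p) {v w : G.Vertex}
    (hv : p.vertexMap v ∈ H.verts) (hw : p.vertexMap w ∈ H.verts) :
    (⟨p.vertexMap ⁻¹' H.verts, p.edgeMap ⁻¹' H.edges⟩ : G.Subgraph).toSemiGraph.subdivision.Reachable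
        (Sum.inl ⟨σ.hom.vertexMap v, preimage_verts_aut p H σ hσ v hv⟩)
        (Sum.inl ⟨σ.hom.vertexMap w, preimage_verts_aut p H σ hσ w hw⟩) ↔
      (⟨p.vertexMap ⁻¹' H.verts, p.edgeMap ⁻¹' H.edges⟩ : G.Subgraph).toSemiGraph.subdivision.Reachable
        (Sum.inl ⟨v, hv⟩) (Sum.inl ⟨w, hw⟩) :=
  Subgraph.reachable_inl_aut_iff _ σ (preimage_verts_aut p H σ hσ) (preimage_edges_aut p H σ hσ)
    (preimage_verts_aut p H σ⁻¹ (Aut.inv_comp_eq_of_hom_comp_eq p σ hσ))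
    (preimage_edges_aut p H σ⁻¹ (Aut.inv_comp_eq_of_hom_comp_eq p σ hσ)) hv hw

/-- **The connected component of the preimage through `c` is a block.** Let `σ ∈ Aut G` lie over
`p : G ⟶ B`, `ℍ ⊆ B`, and `c` a vertex over `ℍ`; write `R c u` for «`u` is joined to `c` by a walk of
the barycentric subdivision of `p⁻¹(ℍ)`» (the connected component of `p⁻¹(ℍ)` through `c`, as a set
of vertices).  If `σ` moves SOME vertex of the component into the component, it maps EVERY vertex of
the component into the component — the components of `p⁻¹(ℍ)` are permuted by the automorphisms over
the base ([IUTchII] Cor. 2.4 (i) p. 71: «γ′ ∈ Δ̂^±_{v□}»). [cite: MochizukiSemiAnbd2006, Lem. 1.8 p.20] -/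
theorem preimage_block_of_over (σ : Aut G) (hσ : σ.hom ≫ p = p) {c : G.Vertex}
    (hc : p.vertexMap c ∈ H.verts)
    (h : ∃ (v : G.Vertex) (hv : p.vertexMap v ∈ H.verts),
      (⟨p.vertexMap ⁻¹' H.verts, p.edgeMap ⁻¹' H.edges⟩ : G.Subgraph).toSemiGraph.subdivision.Reachable
          (Sum.inl ⟨c, hc⟩) (Sum.inl ⟨v, hv⟩) ∧
        (⟨p.vertexMap ⁻¹' H.verts, p.edgeMap ⁻¹' H.edges⟩ : G.Subgraph).toSemiGraph.subdivision.Reachable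
          (Sum.inl ⟨c, hc⟩) (Sum.inl ⟨σ.hom.vertexMap v, preimage_verts_aut p H σ hσ v hv⟩))
    {u : G.Vertex} (hu : p.vertexMap u ∈ H.verts)
    (hcu : (⟨p.vertexMap ⁻¹' H.verts, p.edgeMap ⁻¹' H.edges⟩ : G.Subgraph).toSemiGraph.subdivision.Reachable
      (Sum.inl ⟨c, hc⟩) (Sum.inl ⟨u, hu⟩)) :
    (⟨p.vertexMap ⁻¹' H.verts, p.edgeMap ⁻¹' H.edges⟩ : G.Subgraph).toSemiGraph.subdivision.Reachable
      (Sum.inl ⟨c, hc⟩) (Sum.inl ⟨σ.hom.vertexMap u, preimage_verts_aut p H σ hσ u hu⟩) := by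
  obtain ⟨v, hv, hcv, hcσv⟩ := h
  -- `v ~ u`, hence `σ v ~ σ u`, hence `c ~ σ v ~ σ u`
  have hvu := hcv.symm.trans hcu
  have hσ' := (preimage_reachable_inl_aut_iff p H σ hσ hv hu).mpr hvu
  exact hcσv.trans hσ'

/-- **Block property for a group action over the base.** For an action `ρ : Γ →* Aut G` by
automorphisms over `p : G ⟶ B` and `ℍ ⊆ B`, if `g ∈ Γ` moves some vertex of the connected component
of `p⁻¹(ℍ)` through `c` into that component, then `g` maps the whole component into itself.
[cite: MochizukiSemiAnbd2006, Lem. 1.8 p.20] -/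
theorem preimage_block_of_action {Γ : Type u} [Group Γ] (ρ : Γ →* Aut G)
    (hρ : ∀ g : Γ, (ρ g).hom ≫ p = p) (g : Γ) {c : G.Vertex} (hc : p.vertexMap c ∈ H.verts)
    (h : ∃ (v : G.Vertex) (hv : p.vertexMap v ∈ H.verts),
      (⟨p.vertexMap ⁻¹' H.verts, p.edgeMap ⁻¹' H.edges⟩ : G.Subgraph).toSemiGraph.subdivision.Reachable
          (Sum.inl ⟨c, hc⟩) (Sum.inl ⟨v, hv⟩) ∧
        (⟨p.vertexMap ⁻¹' H.verts, p.edgeMap ⁻¹' H.edges⟩ : G.Subgraph).toSemiGraph.subdivision.Reachable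
          (Sum.inl ⟨c, hc⟩) (Sum.inl ⟨(ρ g).hom.vertexMap v, preimage_verts_aut p H (ρ g) (hρ g) v hv⟩))
    {u : G.Vertex} (hu : p.vertexMap u ∈ H.verts)
    (hcu : (⟨p.vertexMap ⁻¹' H.verts, p.edgeMap ⁻¹' H.edges⟩ : G.Subgraph).toSemiGraph.subdivision.Reachable
      (Sum.inl ⟨c, hc⟩) (Sum.inl ⟨u, hu⟩)) :
    (⟨p.vertexMap ⁻¹' H.verts, p.edgeMap ⁻¹' H.edges⟩ : G.Subgraph).toSemiGraph.subdivision.Reachable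
      (Sum.inl ⟨c, hc⟩) (Sum.inl ⟨(ρ g).hom.vertexMap u, preimage_verts_aut p H (ρ g) (hρ g) u hu⟩) :=
  preimage_block_of_over p H (ρ g) (hρ g) hc h hu hcu

/-- **Stabiliser form.** Under the hypotheses of `preimage_block_of_over`, `σ` also maps the
component ONTO itself: every vertex of the component is the `σ`-image of a vertex of the component
(apply the block property to `σ⁻¹`, which moves `σ v` back into the component).
[cite: MochizukiSemiAnbd2006, Lem. 1.8 p.20] -/
theorem preimage_block_surj_of_over (σ : Aut G) (hσ : σ.hom ≫ p = p) {c : G.Vertex}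
    (hc : p.vertexMap c ∈ H.verts)
    (h : ∃ (v : G.Vertex) (hv : p.vertexMap v ∈ H.verts),
      (⟨p.vertexMap ⁻¹' H.verts, p.edgeMap ⁻¹' H.edges⟩ : G.Subgraph).toSemiGraph.subdivision.Reachable
          (Sum.inl ⟨c, hc⟩) (Sum.inl ⟨v, hv⟩) ∧
        (⟨p.vertexMap ⁻¹' H.verts, p.edgeMap ⁻¹' H.edges⟩ : G.Subgraph).toSemiGraph.subdivision.Reachable
          (Sum.inl ⟨c, hc⟩) (Sum.inl ⟨σ.hom.vertexMap v, preimage_verts_aut p H σ hσ v hv⟩))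
    {u : G.Vertex} (hu : p.vertexMap u ∈ H.verts)
    (hcu : (⟨p.vertexMap ⁻¹' H.verts, p.edgeMap ⁻¹' H.edges⟩ : G.Subgraph).toSemiGraph.subdivision.Reachable
      (Sum.inl ⟨c, hc⟩) (Sum.inl ⟨u, hu⟩)) :
    (⟨p.vertexMap ⁻¹' H.verts, p.edgeMap ⁻¹' H.edges⟩ : G.Subgraph).toSemiGraph.subdivision.Reachable
      (Sum.inl ⟨c, hc⟩) (Sum.inl ⟨σ.inv.vertexMap u,
        preimage_verts_aut p H σ⁻¹ (Aut.inv_comp_eq_of_hom_comp_eq p σ hσ) u hu⟩) := by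
  obtain ⟨v, hv, hcv, hcσv⟩ := h
  have hσi : (σ⁻¹).hom ≫ p = p := Aut.inv_comp_eq_of_hom_comp_eq p σ hσ
  -- `σ⁻¹` moves `σ v` (in the component) to `v` (in the component)
  refine preimage_block_of_over p H σ⁻¹ hσi hc ⟨σ.hom.vertexMap v,
    preimage_verts_aut p H σ hσ v hv, hcσv, ?_⟩ hu hcu
  have e1 : (⟨(σ⁻¹).hom.vertexMap (σ.hom.vertexMap v),
      preimage_verts_aut p H σ⁻¹ hσi _ (preimage_verts_aut p H σ hσ v hv)⟩ :
        (⟨p.vertexMap ⁻¹' H.verts, p.edgeMap ⁻¹' H.edges⟩ : G.Subgraph).toSemiGraph.Vertex) =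
      ⟨v, hv⟩ := Subtype.ext (inv_vertexMap_hom_vertexMap σ v)
  rw [e1]
  exact hcv

end Preimage

/-! ### An open edge abuts to at most one vertex -/

/-- The verticial portion of an edge is finite (it lies in the two-element set of branches of the
edge). [cite: MochizukiSemiAnbd2006, §1 p.11] -/
theorem verticialPortion_finite (e : G.Edge) : (G.verticialPortion e).Finite := by
  obtain ⟨b₁, b₂, -, -, -, hall⟩ := G.two_branches e
  exact (Set.toFinite ({b₁, b₂} : Set G.Branch)).subset fun b hb => by
    rcases hall b hb.1 with rfl | rfl <;> simp

/-- **A cusp meets one vertex.** An edge of verticial cardinality `≤ 1` (e.g. an open edge,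
`IsOpenEdge`: `< 2`) abuts to at most one vertex: if it abuts to `v` and to `w` then `v = w` (its unique
abutting branch carries both). [cite: MochizukiSemiAnbd2006, §1 p.12] -/
theorem eq_of_edgeAbuts_of_vertCard_le_one {e : G.Edge} (he : G.vertCard e ≤ 1) {v w : G.Vertex}
    (hv : G.EdgeAbuts e v) (hw : G.EdgeAbuts e w) : v = w := by
  obtain ⟨b₁, hb₁e, hb₁v⟩ := hv
  obtain ⟨b₂, hb₂e, hb₂w⟩ := hw
  have h1 : b₁ ∈ G.verticialPortion e := ⟨hb₁e, by rw [hb₁v]; rfl⟩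
  have hpos : 0 < G.vertCard e := (Set.ncard_pos (verticialPortion_finite e)).mpr ⟨b₁, h1⟩
  have hone : G.vertCard e = 1 := by omega
  obtain ⟨b, -, -, huniq⟩ := existsUnique_abuts_of_vertCard_eq_one (G := G) hone
  have e1 : b₁ = b := huniq b₁ hb₁e (by rw [hb₁v]; rfl)
  have e2 : b₂ = b := huniq b₂ hb₂e (by rw [hb₂w]; rfl)
  have : G.abuts b₁ = G.abuts b₂ := by rw [e1, e2]
  rw [hb₁v, hb₂w] at this
  exact Option.some_injective _ this

/-- An open edge (`vertCard < 2`) abuts to at most one vertex. [cite: MochizukiSemiAnbd2006, §1 p.12] -/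
theorem eq_of_edgeAbuts_of_isOpenEdge {e : G.Edge} (he : G.IsOpenEdge e) {v w : G.Vertex}
    (hv : G.EdgeAbuts e v) (hw : G.EdgeAbuts e w) : v = w :=
  eq_of_edgeAbuts_of_vertCard_le_one (Nat.le_of_lt_succ he) hv hw

end SemiGraph

end Literature.AnabelianGeometry.SemiGraphs
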